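import Summits.BirchSwinnertonDyer.Rank1Residual.X10.MuZeroRoadThree
import Summits.BirchSwinnertonDyer.BirchSwinnertonDyer.Theorems.Rank1ResidualX10bMuTransfer
import HarnessLib

/-!
# Class X10 ∩ {r = 0} at `p = 3` (X10a′ AND X10b = N2), the `μ`-ZERO ROAD with `μ = 0` DISCHARGED by the
# `μ`-transfer: `KatoMuTransferThree` ∧ one unit coefficient of `L_3(f, α)` ⟹ (X_A3 ⟺ `BSD(E,3)`) and
# the Euler-system half, with NO image hypothesis and NO class predicate — and the same read off a
# LITERAL integer model, the shape of GEN 34's per-cell RECORDS (cell `b2b-bsdres`, unit `b2b-bsdres-x10`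
# = N2 class lead, GEN 35; TOOL — theorems only, no definition, no named fact, nothing booked)

HONEST FRAMING (run/shared/lean/b2b/bsd-rank1-residual/, verbatim in every file): the goal of the
cell is to DELETE the COMBINATION-SHAPED residual classes of the Birch–Swinnerton-Dyer formula for
ALL analytic-rank `≤ 1` elliptic curves over `ℚ` — "full BSD formula for every rank `≤ 1` curve in
class `C`" assembled STRICTLY from published theorems — so that the rank-`≤ 1` remainder becomes
exactly the CONSTRUCTION-SHAPED classes, which are TYPED (missing-input `Prop`s), NOT attempted.
This is not "finishing BSD". Class X10b (N2) keeps its label CONSTRUCTION-SHAPED / NEEDS X_A3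
(RESIDUAL-MAP §I N2); nothing is booked by this file; no census number moves.

## What (x10 GEN 35, X10-AUDIT §41; companion of `X10/MuTransferThreeEulerHalf.lean`)

GEN 34's records (`X10/MuZeroRoadRecordsA–M`, 133 rank-`0` N2 cells without a trivial road) read
"X_A3 AT THE PAIR (`MazurMainConjecture W 3`) MODULO `hμ` = Greenberg's Conj. 1.11 at `(E,3)` (every
cyclotomic datum, OPEN per pair) and the booked `BSD(E,3)`", from a literal integer model
(`MuZeroRoad.mazurMainConjecture_three_of_ainvs_of_greenbergMu_of_bsdp`). THIS FILE replaces the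
per-pair open hypothesis `hμ` by ONE class-level open node + ONE finite certificate: the cell
`bsd-smallim`'s `KatoMuTransferThree` (KOLY-MEMO §5.7 at `p = 3`, p407527: at a good ordinary `3` with
`E[3]` irreducible and `ρ̄_{E,3}` NOT surjective, a unit coefficient of `L_3(f, α)` forces `μ(X) = 0`)
and `hcertA` (one `3`-adic unit coefficient of `L_3(f, α)` for the newforms of `E` — the `μ^an = 0`
certificate, a finite exact modular-symbol computation). When `ρ̄_{E,3}` IS surjective no transfer is
needed: the good-ordinary tower (`surjective_pow_of_goodOrd_of_surj`, Wuthrich's Lemma 20 as a tree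
theorem) gives Kato's (12.5.2) and the integral clause 17.4 (3) (x10 GEN 5/13). Hence, with NO image
hypothesis and no class predicate (only `3` good ordinary, `E[3]` irreducible, `L(E,1) ≠ 0`):

* `mu_eq_zero_three_of_katoMuTransferThree` — the transfer at a pair in class-free form (`¬ Surj W 3`);
* `mazurMainConjecture_iff_bsdp_three_of_katoMuTransferThree` — **`KatoMuTransferThree` ∧ `hcertA` ⟹
  (`MazurMainConjecture W 3 ↔ BSDp W 3`)**, EITHER image;
* `missingUpperBoundAt_three_of_katoMuTransferThree` — **⟹ `ord₃ #Ш(E/ℚ) ≤ ord₃ #Ш(E/ℚ)_an`**, EITHER image;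
* `MuZeroRoad.mazurMainConjecture_three_of_ainvs_of_katoMuTransferThree_of_bsdp`,
  `MuZeroRoad.missingUpperBoundAt_three_of_ainvs_of_katoMuTransferThree` — the same two read off a
  LITERAL integer model `[a₁,…,a₆]` (`3 ∤ Δ`; `countPoints [a₁,…,a₆] 3 = n₃` with `3 ∤ 4 − n₃`; a Frobenius
  witness `ℓ` with `X² − (ℓ+1−n)X + ℓ` root-free mod `3` — GEN 34's `goodOrdIrr_three_of_ainvs_of_countPoints`),
  i.e. GEN 34's record shape with `hμ` replaced by (`hT3`, `hcertA`): **every one of GEN 34's 133 records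
  upgrades verbatim** (same `decide`d cell data, same `hbsd`) to "X_A3 AT THE PAIR ⟸ `KatoMuTransferThree`
  + the `μ^an = 0` certificate + the booked `BSD(E,3)`" — no per-cell file is re-issued here (one
  application per cell, on demand).

PUBLISHED binders displayed: `kato_divisibility` (`hkato`/`hK`; clause (2), and clause (3) on the
surjective branch), Schneider 1985 / BMS odd (`hS`) + Mazur–Stein–Tate σ odd (`hMT`) for Greenberg's
Thm. 4.1, modularity (`hmodP`), GZK (`hGZK`), the period unit at `3` (`h3`). Where `3` enters: `p = 3` is
the prime of `KatoMuTransferThree`; everything else is stated for odd `p`.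

References: [Kato2004Asterisque] Thm. 17.4 (2), (3) (p. 273), Thm. 12.6, 17.13; [GreenbergLNM1716]
Conj. 1.11, Thm. 4.1, §5; [GreenbergVatsal2000] (1)–(2), Prop. 3.7; [Wuthrich2014] Lemma 20, Prop. 21;
[Mazur1978] Prop. 6.3 (1); [Miller2011LMS] Def. 1.1; cell files X10-AUDIT.md §40–§41;
HOME/pub/bsd-smallim/koly/KOLY-MEMO.md §5.7.
-/

set_option autoImplicit false

noncomputable section

open scoped Classical MatrixGroups ModularForm

open CongruenceSubgroup WeierstrassCurve Literature.NumberTheory.EllipticCurves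
  Literature.NumberTheory.EllipticCurves.ModularForms Literature.NumberTheory.EllipticCurves.Rank1Residual
  Literature.NumberTheory.EllipticCurves.Rank1Residual.Typed
  Literature.NumberTheory.EllipticCurves.Wuthrich2014
  Literature.NumberTheory.EllipticCurves.Rank1Residual.X11RankOneCertificates
  Summit.BirchSwinnertonDyer.BirchSwinnertonDyer.Rank1Residual.IntModel
  Summit.BirchSwinnertonDyer.BirchSwinnertonDyer.Rank1Residual.X11RankOne
  Summit.BirchSwinnertonDyer.BirchSwinnertonDyer.Theorems.Rank1ResidualX1Defs
  Summit.BirchSwinnertonDyer.BirchSwinnertonDyer.Rank1Residual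

namespace Summit.BirchSwinnertonDyer.Rank1Residual.X10

/-! ### §1. Class-free, image-free forms at `p = 3` -/

section ClassFree

variable (W : WeierstrassCurve ℚ) [W.IsElliptic] [W.IsGloballyMinimal]

/-- **The `μ`-transfer at a pair, class-free form**: at a good ordinary `3` with `E[3]` irreducible and
`ρ̄_{E,3}` NOT surjective, `KatoMuTransferThree` ∧ one unit coefficient of `L_3(f, α)` for the newforms of
`W` (`hcertA`; a newform exists by `hmodP`) ⟹ `μ(X) = 0` for every cyclotomic datum at `3`. (Koly's
`x10b_mu_eq_zero_of_katoMuTransferThree` without the `ClassX10` wrapper.) [folklore] -/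
theorem mu_eq_zero_three_of_katoMuTransferThree
    (hmodP : nonempty_modularParametrizationData) (hT3 : KatoMuTransferThree) [Fact (Nat.Prime 3)]
    (hgood : W.HasGoodReductionAtPrime 3) (hord : ¬ ((3 : ℕ) : ℤ) ∣ W.frobeniusTrace 3)
    (hirr : W.HasIrreducibleModPGaloisRep 3) (hns : ¬ Surj W 3)
    (hcertA : ∀ {N : ℕ} [NeZero N] (f : CuspForm (Gamma0 N) 2), IsNewformOf W f →
      ∃ n : ℕ, ‖PowerSeries.coeff n (padicLFunction f (unitRoot W 3 : ℚ_[3]))‖ = 1) :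
    ∀ (κ : ZpExtension ℚ 3) (γ : Field.absoluteGaloisGroup ℚ),
      κ.IsCyclotomic → κ.IsTopGenerator γ → IsCyclotomicVariable 3 γ →
      ∀ D : W.SelmerDualData κ γ, D.mu = 0 := by
  intro κ γ hκ hγ hγ' D
  haveI : NeZero (W.conductorNorm ℤ) := ⟨(W.conductorNorm_pos_holds).ne'⟩
  obtain ⟨Dm⟩ := hmodP W
  exact hT3 W 3 Dm.f rfl hgood hord hirr hns Dm.isNewformOf (hcertA Dm.f Dm.isNewformOf) κ γ hκ hγ hγ' D

/-- **`3` good ordinary, `E[3]` irreducible, `L(E,1) ≠ 0`, EITHER image: `KatoMuTransferThree` ∧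
certificate ⟹ (`MazurMainConjecture W 3 ↔ BSDp W 3`).** Surjective `ρ̄_{E,3}`: the good-ordinary tower
(`surjective_pow_of_goodOrd_of_surj`) + Kato (3) (`mainConjecture_iff_bsdp_of_kato`, x10 GEN 5), the
certificate unused; non-surjective: §1's `μ = 0` into GEN 34's `mainConjecture_iff_bsdp_of_kato_of_greenbergMu`
(Kato (2)). PUBLISHED `hK`, `hS` + `hMT`, `hmodP`, `hGZK`, `h3`; CELL input `hT3`; certificate `hcertA`.
[cite: Kato2004Asterisque, Thm. 17.4 (2), (3) (p. 273)] [cite: GreenbergLNM1716, §1 Conj. 1.11, Thm. 4.1 and §5]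
[cite: Wuthrich2014, Lemma 20 (p. 399)] [cite: Miller2011LMS, Def. 1.1 (arXiv:1010.2431 p. 3)] -/
theorem mazurMainConjecture_iff_bsdp_three_of_katoMuTransferThree
    (hS : Schneider1985_order_charGenerator_odd) (hMT : mazur_tate_sigma_exists_odd)
    (hmodP : nonempty_modularParametrizationData)
    (hGZK : rank_eq_analyticRank_of_analyticRank_le_one)
    (h3 : realPeriodRat_eq_unit_mul_plusPeriod_three) (hT3 : KatoMuTransferThree)
    (hK : ∀ (κ : ZpExtension ℚ 3) (γ : Field.absoluteGaloisGroup ℚ) [NeZero (W.conductorNorm ℤ)]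
      (f : CuspForm (Gamma0 (W.conductorNorm ℤ)) 2), kato_divisibility W 3 (κ := κ) (γ := γ) (f := f))
    (hgood : W.HasGoodReductionAtPrime 3) (hord : ¬ ((3 : ℕ) : ℤ) ∣ W.frobeniusTrace 3)
    (hirr : W.HasIrreducibleModPGaloisRep 3) (hL : W.entireLFunction 1 ≠ 0)
    (hcertA : ∀ {N : ℕ} [NeZero N] (f : CuspForm (Gamma0 N) 2), IsNewformOf W f →
      ∃ n : ℕ, ‖PowerSeries.coeff n (padicLFunction f (unitRoot W 3 : ℚ_[3]))‖ = 1) :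
    MazurMainConjecture W 3 ↔ BSDp W 3 := by
  have hϖ : ∀ [NeZero (W.conductorNorm ℤ)] (f : CuspForm (Gamma0 (W.conductorNorm ℤ)) 2),
      IsNewformOf W f → ∀ ϖ : ℚ, (ϖ : ℝ) * W.realPeriodRat = plusPeriod f → padicValRat 3 ϖ = 0 :=
    fun f hf ϖ hϖeq ↦ padicValRat_periodRatio_eq_zero_three W h3 hgood hirr f hf ϖ hϖeq
  by_cases hsurj : Surj W 3
  · exact mainConjecture_iff_bsdp_of_kato W 3 (greenberg_charValue_rankZero_of_Schneider1985_odd hS hMT)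
      hmodP hGZK hK (by decide) hgood hord
      (surjective_pow_of_goodOrd_of_surj W (by decide) ⟨hgood, hord⟩ hsurj) hL hϖ
  · exact mainConjecture_iff_bsdp_of_kato_of_greenbergMu W 3
      (greenberg_charValue_rankZero_of_Schneider1985_odd hS hMT) hmodP hGZK hK (by decide) hgood hord
      hirr hL hϖ (mu_eq_zero_three_of_katoMuTransferThree W hmodP hT3 hgood hord hirr hsurj hcertA)

/-- **`3` good ordinary, `E[3]` irreducible, `L(E,1) ≠ 0`, EITHER image: `KatoMuTransferThree` ∧
certificate ⟹ the Euler-system half `ord₃ #Ш(E/ℚ) ≤ ord₃ #Ш(E/ℚ)_an`** (`Typed.MissingUpperBoundAt W 3`).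
Surjective: x10 GEN 5's `missingUpperBoundAt_of_kato_of_surjective_pow` on the tower; non-surjective: GEN
34's `missingUpperBoundAt_of_kato_of_greenbergMu` with `μ = 0` from §1. Binders as above.
[cite: Kato2004Asterisque, Thm. 17.4 (2), (3) (p. 273)] [cite: GreenbergLNM1716, §1 Conj. 1.11 and Thm. 4.1 (p. 102)]
[cite: Wuthrich2014, Lemma 20 (p. 399) and Prop. 21 (p. 400)] -/
theorem missingUpperBoundAt_three_of_katoMuTransferThree
    (hS : Schneider1985_order_charGenerator_odd) (hMT : mazur_tate_sigma_exists_odd)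
    (hmodP : nonempty_modularParametrizationData)
    (hGZK : rank_eq_analyticRank_of_analyticRank_le_one)
    (h3 : realPeriodRat_eq_unit_mul_plusPeriod_three) (hT3 : KatoMuTransferThree)
    (hK : ∀ (κ : ZpExtension ℚ 3) (γ : Field.absoluteGaloisGroup ℚ) [NeZero (W.conductorNorm ℤ)]
      (f : CuspForm (Gamma0 (W.conductorNorm ℤ)) 2), kato_divisibility W 3 (κ := κ) (γ := γ) (f := f))
    (hgood : W.HasGoodReductionAtPrime 3) (hord : ¬ ((3 : ℕ) : ℤ) ∣ W.frobeniusTrace 3)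
    (hirr : W.HasIrreducibleModPGaloisRep 3) (hL : W.entireLFunction 1 ≠ 0)
    (hcertA : ∀ {N : ℕ} [NeZero N] (f : CuspForm (Gamma0 N) 2), IsNewformOf W f →
      ∃ n : ℕ, ‖PowerSeries.coeff n (padicLFunction f (unitRoot W 3 : ℚ_[3]))‖ = 1) :
    Typed.MissingUpperBoundAt W 3 := by
  have hϖ : ∀ [NeZero (W.conductorNorm ℤ)] (f : CuspForm (Gamma0 (W.conductorNorm ℤ)) 2),
      IsNewformOf W f → ∀ ϖ : ℚ, (ϖ : ℝ) * W.realPeriodRat = plusPeriod f → padicValRat 3 ϖ = 0 :=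
    fun f hf ϖ hϖeq ↦ padicValRat_periodRatio_eq_zero_three W h3 hgood hirr f hf ϖ hϖeq
  by_cases hsurj : Surj W 3
  · exact missingUpperBoundAt_of_kato_of_surjective_pow W 3
      (greenberg_charValue_rankZero_of_Schneider1985_odd hS hMT) hmodP hGZK hK (by decide) hgood hord
      (surjective_pow_of_goodOrd_of_surj W (by decide) ⟨hgood, hord⟩ hsurj) hL hϖ
  · exact missingUpperBoundAt_of_kato_of_greenbergMu W 3
      (greenberg_charValue_rankZero_of_Schneider1985_odd hS hMT) hmodP hGZK hK (by decide) hgood hord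
      hirr hL hϖ (mu_eq_zero_three_of_katoMuTransferThree W hmodP hT3 hgood hord hirr hsurj hcertA)

end ClassFree

/-! ### §2. The same read off a literal integer model — GEN 34's record shape with `hμ` discharged -/

namespace MuZeroRoad

/-- **`KatoMuTransferThree` ∧ certificate ∧ `BSD(E,3)` ⟹ X_A3 at the pair, `MazurMainConjecture W 3`,
for a cell given by a literal integer model** — GEN 34's `mazurMainConjecture_three_of_ainvs_of_greenbergMu_of_bsdp`
with its per-pair OPEN hypothesis `hμ` (Greenberg's Conj. 1.11 at the pair) REPLACED by the class-level
open node `hT3` and the finite certificate `hcertA` (plus `hmodP`, to run the certificate through a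
newform); EITHER image. Cell data (`decide`d per cell, unchanged from GEN 34): `3 ∤ Δ`,
`countPoints [a₁,…,a₆] 3 = n₃` with `3 ∤ 4 − n₃`, a Frobenius witness `ℓ` with `X² − (ℓ+1−n)X + ℓ`
root-free mod `3`; census binder `hL : L(E,1) ≠ 0`; `hbsd : BSDp W 3` booked per pair by the lane's
certificates. Every one of the 133 GEN 34 records `mazurMainConjecture_e<label>_of_greenbergMu` upgrades
by this theorem with the same arguments. Per pair; no class statement; nothing booked.
[cite: Kato2004Asterisque, Thm. 17.4 (2), (3) (p. 273)] [cite: GreenbergLNM1716, §1 Conj. 1.11 and §5 (closing examples)]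
[cite: Mazur1978, §6 Prop. 6.3 (1) (p. 153)] [cite: Miller2011LMS, Def. 1.1 (arXiv:1010.2431 p. 3)] -/
theorem mazurMainConjecture_three_of_ainvs_of_katoMuTransferThree_of_bsdp
    (hkato : ∀ (W : WeierstrassCurve ℚ) [W.IsElliptic] [W.IsGloballyMinimal] (p : ℕ) [Fact p.Prime]
      (κ : ZpExtension ℚ p) (γ : Field.absoluteGaloisGroup ℚ) (N : ℕ) [NeZero N]
      (f : CuspForm (Gamma0 N) 2), kato_divisibility W p (κ := κ) (γ := γ) (f := f))
    (hS : Schneider1985_order_charGenerator_odd) (hMT : mazur_tate_sigma_exists_odd)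
    (hmodP : nonempty_modularParametrizationData)
    (hGZK : rank_eq_analyticRank_of_analyticRank_le_one)
    (h3 : realPeriodRat_eq_unit_mul_plusPeriod_three) (hT3 : KatoMuTransferThree)
    (a1 a2 a3 a4 a6 : ℤ) {W : WeierstrassCurve ℚ} [W.IsElliptic] [W.IsGloballyMinimal]
    (hW : integralModelInt W = ⟨a1, a2, a3, a4, a6⟩)
    [Fact (Nat.Prime 3)] (ℓ n n3 : ℕ) [Fact ℓ.Prime]
    (h3Δ : ¬ (3 : ℤ) ∣ discOf [a1, a2, a3, a4, a6])
    (hc3 : countPoints [a1, a2, a3, a4, a6] 3 = n3) (hord3 : ¬ (3 : ℤ) ∣ (3 : ℤ) + 1 - n3)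
    (hℓ2 : ℓ ≠ 2) (hℓ3 : ℓ ≠ 3) (hℓΔ : ¬ (ℓ : ℤ) ∣ discOf [a1, a2, a3, a4, a6])
    (hc : countPoints [a1, a2, a3, a4, a6] ℓ = n)
    (hnoroot : ∀ t : ℕ, t < 3 → ¬ (3 : ℤ) ∣ (t : ℤ) ^ 2 - ((ℓ : ℤ) + 1 - n) * t + ℓ)
    (hL : W.entireLFunction 1 ≠ 0)
    (hcertA : ∀ {N : ℕ} [NeZero N] (f : CuspForm (Gamma0 N) 2), IsNewformOf W f →
      ∃ n : ℕ, ‖PowerSeries.coeff n (padicLFunction f (unitRoot W 3 : ℚ_[3]))‖ = 1)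
    (hbsd : BSDp W 3) : MazurMainConjecture W 3 := by
  obtain ⟨hgood, hord, hirr⟩ := goodOrdIrr_three_of_ainvs_of_countPoints a1 a2 a3 a4 a6 hW ℓ n n3 h3Δ
    hc3 hord3 hℓ2 hℓ3 hℓΔ hc hnoroot
  exact (mazurMainConjecture_iff_bsdp_three_of_katoMuTransferThree W hS hMT hmodP hGZK h3 hT3
    (fun κ γ _ f ↦ hkato W 3 κ γ (W.conductorNorm ℤ) f) hgood hord hirr hL hcertA).mpr hbsd

/-- **`KatoMuTransferThree` ∧ certificate ⟹ `ord₃ #Ш(E/ℚ) ≤ ord₃ #Ш(E/ℚ)_an`, for a cell given by a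
literal integer model** — GEN 34's `missingUpperBoundAt_three_of_ainvs_of_greenbergMu` with `hμ`
replaced by (`hT3`, `hcertA`); EITHER image. Per pair; nothing booked.
[cite: Kato2004Asterisque, Thm. 17.4 (2), (3) (p. 273)] [cite: GreenbergLNM1716, §1 Conj. 1.11 and Thm. 4.1]
[cite: Mazur1978, §6 Prop. 6.3 (1) (p. 153)] -/
theorem missingUpperBoundAt_three_of_ainvs_of_katoMuTransferThree
    (hkato : ∀ (W : WeierstrassCurve ℚ) [W.IsElliptic] [W.IsGloballyMinimal] (p : ℕ) [Fact p.Prime]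
      (κ : ZpExtension ℚ p) (γ : Field.absoluteGaloisGroup ℚ) (N : ℕ) [NeZero N]
      (f : CuspForm (Gamma0 N) 2), kato_divisibility W p (κ := κ) (γ := γ) (f := f))
    (hS : Schneider1985_order_charGenerator_odd) (hMT : mazur_tate_sigma_exists_odd)
    (hmodP : nonempty_modularParametrizationData)
    (hGZK : rank_eq_analyticRank_of_analyticRank_le_one)
    (h3 : realPeriodRat_eq_unit_mul_plusPeriod_three) (hT3 : KatoMuTransferThree)
    (a1 a2 a3 a4 a6 : ℤ) {W : WeierstrassCurve ℚ} [W.IsElliptic] [W.IsGloballyMinimal]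
    (hW : integralModelInt W = ⟨a1, a2, a3, a4, a6⟩)
    [Fact (Nat.Prime 3)] (ℓ n n3 : ℕ) [Fact ℓ.Prime]
    (h3Δ : ¬ (3 : ℤ) ∣ discOf [a1, a2, a3, a4, a6])
    (hc3 : countPoints [a1, a2, a3, a4, a6] 3 = n3) (hord3 : ¬ (3 : ℤ) ∣ (3 : ℤ) + 1 - n3)
    (hℓ2 : ℓ ≠ 2) (hℓ3 : ℓ ≠ 3) (hℓΔ : ¬ (ℓ : ℤ) ∣ discOf [a1, a2, a3, a4, a6])
    (hc : countPoints [a1, a2, a3, a4, a6] ℓ = n)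
    (hnoroot : ∀ t : ℕ, t < 3 → ¬ (3 : ℤ) ∣ (t : ℤ) ^ 2 - ((ℓ : ℤ) + 1 - n) * t + ℓ)
    (hL : W.entireLFunction 1 ≠ 0)
    (hcertA : ∀ {N : ℕ} [NeZero N] (f : CuspForm (Gamma0 N) 2), IsNewformOf W f →
      ∃ n : ℕ, ‖PowerSeries.coeff n (padicLFunction f (unitRoot W 3 : ℚ_[3]))‖ = 1) :
    Typed.MissingUpperBoundAt W 3 := by
  obtain ⟨hgood, hord, hirr⟩ := goodOrdIrr_three_of_ainvs_of_countPoints a1 a2 a3 a4 a6 hW ℓ n n3 h3Δ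
    hc3 hord3 hℓ2 hℓ3 hℓΔ hc hnoroot
  exact missingUpperBoundAt_three_of_katoMuTransferThree W hS hMT hmodP hGZK h3 hT3
    (fun κ γ _ f ↦ hkato W 3 κ γ (W.conductorNorm ℤ) f) hgood hord hirr hL hcertA

end MuZeroRoad

end Summit.BirchSwinnertonDyer.Rank1Residual.X10

end
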